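import Mathlib.Analysis.SpecialFunctions.Pow.Real
import Mathlib.Analysis.SpecialFunctions.Log.Basic
import Mathlib.Analysis.Asymptotics.SpecificAsymptotics
import Mathlib.Analysis.SpecialFunctions.Pow.Asymptotics
import Literature.MathematicalPhysics.QuantumFieldTheory.Balaban1983to89.B4Eq19LatticeOperators
import HarnessLib

/-!
# Crux stmt-QuantumFields-19936 `UnitScaleTilt.HistoryTailL`, route crux `PoincareLipschitz.BlockLipschitzL` (stmt-QuantumFields-23533), K2 END-GAME knit
# `hRegH ⟸ hImprove ∧ [A] ∧ [T2] ∧ [C] ∧ [D]` — SMALL LETTERS for two generic rows of the final knit (★w2-19936 g11's `K2-FINAL-KNIT-RECIPE`):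
# §1 the «sum over an injective image ≤ sum over a superset of nonnegative terms» transfer of a box energy in flat-shadow letters to a bond sum on any index type
# (recipe step 4: [A]'s plateau bound ⟹ `hImprove`'s bounded-energy row), §2 the pure-real «NO log loss» arithmetic of the scale loss `R ≤ C₀·(log R)⁶·r` of
# `hImprove` v1 (LEAD ★w1-19936 g9 RULING g9-3: exponent 6; recipe step 8) and the bridge «log calibration ⟹ power calibration `R ≤ r²`», §3 the face algebra at the
# [T2] box radius `R′ = min R (c·θ^{−1/2})` (RULING g9-2: `(√R′)⁻¹ + √θ√R′ ≤ (c^{−1/2} + 1)·((√R)⁻¹ + √θ√R)`, `2θ^{1/4} ≤ (√R)⁻¹ + √θ√R`).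

Cell `ym3-torus` (YM ladder rung R3 = continuum SU(2) Yang–Mills on T³ — a RUNG, NOT the Clay problem: not d = 4, not infinite volume, not a mass gap); width seat
`ym-ust-19936-w7` g12 (LEAD ★w1-19936 g9 06:26:40Z «KNIT SMALL LETTERS §1 + §2 GO with exponent 6, + §3»), helper `--supports stmt-QuantumFields-19936`; THEOREMS ONLY
(0 `def`, 0 `sorry`, default heartbeats).  No lattice gauge objects: §1 is a `Finset` lemma over `Zd d` boxes, §2–§3 are real analysis (`Real.log`, `Real.sqrt`, `rpow`,
Mathlib's `Real.isLittleO_pow_log_id_atTop`).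
HONEST SCOPE.  Letters and arithmetic; nothing of `hImprove`, `hRegH`, [C], [D], `BlockLipschitzL`, `HistoryTailL` or a summit statement is proved here.
[folklore]
-/

set_option autoImplicit false

noncomputable section

open scoped BigOperators
open Finset Filter Asymptotics

namespace Summit.QuantumFields.YangMills.Theorems.PoincareLipschitzKnitScaleLetters

open Literature.MathematicalPhysics.QuantumFieldTheory.Balaban1983to89
open B4Eq19LatticeOperators (Zd box unitVec)

/-! ## §1 Box energies in flat-shadow letters are bounded by bond sums over any superset of the chart image -/

/-- ★ **SUM OVER AN INJECTIVE IMAGE ≤ SUM OVER A SUPERSET OF NONNEGATIVE TERMS** (box × axis version).  If the bond letter `e : Zd d → Fin d → β` is injective on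
`Q ×ˢ univ`, every `e y μ` (`y ∈ Q`) lies in the finset `T`, `f ≥ 0` on `T`, and `g y μ = f (e y μ)` on `Q`, then `Σ_{y∈Q} Σ_μ g y μ ≤ Σ_{b∈T} f b`.
(Recipe step 4: `Q = box z r'`, `e y μ = ⟨c y, μ⟩`, `g y μ = ‖τ μ y (u(y+e_μ)) − u y‖²`, `f b = dist1(V_b·((W^h)_b)⁻¹)²`, `T = S.filter plateau`.) [folklore] -/
theorem sum_le_sum_of_injOn_nonneg {d : ℕ} {β : Type*} [DecidableEq β] (Q : Finset (Zd d)) (e : Zd d → Fin d → β)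
    (he : Set.InjOn (fun p : Zd d × Fin d => e p.1 p.2) ↑(Q ×ˢ (Finset.univ : Finset (Fin d))))
    (T : Finset β) (hT : ∀ y ∈ Q, ∀ μ, e y μ ∈ T) (f : β → ℝ) (hf : ∀ b ∈ T, 0 ≤ f b)
    (g : Zd d → Fin d → ℝ) (hg : ∀ y ∈ Q, ∀ μ, g y μ = f (e y μ)) :
    ∑ y ∈ Q, ∑ μ, g y μ ≤ ∑ b ∈ T, f b := by
  classical
  have h1 : ∑ y ∈ Q, ∑ μ, g y μ = ∑ p ∈ Q ×ˢ (Finset.univ : Finset (Fin d)), f (e p.1 p.2) := by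
    rw [Finset.sum_product]
    refine Finset.sum_congr rfl fun y hy => Finset.sum_congr rfl fun μ _ => hg y hy μ
  have h2 : ∑ p ∈ Q ×ˢ (Finset.univ : Finset (Fin d)), f (e p.1 p.2) =
      ∑ b ∈ (Q ×ˢ (Finset.univ : Finset (Fin d))).image (fun p : Zd d × Fin d => e p.1 p.2), f b := by
    rw [Finset.sum_image]
    exact he
  rw [h1, h2]
  refine Finset.sum_le_sum_of_subset_of_nonneg ?_ fun b hb _ => hf b hb
  intro b hb
  obtain ⟨p, hp, rfl⟩ := Finset.mem_image.mp hb
  exact hT p.1 (Finset.mem_product.mp hp).1 p.2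

/-- ★ The chart-bond letter is injective on `Q ×ˢ univ` as soon as the chart is injective on `Q`: for any `mk : α → Fin d → β` with `mk`-components readable
(`src (mk a μ) = a`, `dir (mk a μ) = μ`), `(y, μ) ↦ mk (c y) μ` is injective on `Q ×ˢ univ` when `c` is injective on `Q`.  (Recipe step 4 with `mk a μ = ⟨a, μ⟩ :
PBond P i`, `src = PBond.src`, `dir = PBond.dir`, and `Set.InjOn c Q` from ✓`injOn_chart_box`.) [folklore] -/
theorem injOn_bond_of_injOn_chart {d : ℕ} {α β : Type*} (Q : Finset (Zd d)) (c : Zd d → α) (hc : Set.InjOn c ↑Q)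
    (mk : α → Fin d → β) (src : β → α) (dir : β → Fin d) (hsrc : ∀ a μ, src (mk a μ) = a) (hdir : ∀ a μ, dir (mk a μ) = μ) :
    Set.InjOn (fun p : Zd d × Fin d => mk (c p.1) p.2) ↑(Q ×ˢ (Finset.univ : Finset (Fin d))) := by
  intro p hp q hq hpq
  have hp1 : p.1 ∈ Q := (Finset.mem_product.mp (Finset.mem_coe.mp hp)).1
  have hq1 : q.1 ∈ Q := (Finset.mem_product.mp (Finset.mem_coe.mp hq)).1
  have h1 : c p.1 = c q.1 := by
    have := congrArg src hpq
    simpa [hsrc] using this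
  have h2 : p.2 = q.2 := by
    have := congrArg dir hpq
    simpa [hdir] using this
  exact Prod.ext (hc (Finset.mem_coe.mpr hp1) (Finset.mem_coe.mpr hq1) h1) h2

/-! ## §2 The scale-loss arithmetic of the read-back (recipe step 8, exponent 6 of RULING g9-3) and the log ⟹ power calibration bridge -/

/-- ★ **THE LOG SCALE LOSS IS EVENTUALLY A POWER SCALE LOSS.**  For every `C₀` there is `R₁ ≥ 1` such that `R₁ ≤ R`, `0 < r` and `R ≤ C₀·(log R)⁶·r` imply `R ≤ r²`
(because `C₀²(log R)¹² ≤ R` eventually, Mathlib `Real.isLittleO_pow_log_id_atTop`).  So the log-calibrated `hImprove` v1 scale clause implies the power-calibrated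
«hImprove-H» clause of the 2026-08-29 05:59:16Z reader's check, and past `R₁(C₀)` one has `log R ≤ 2·log r`. [folklore] -/
theorem exists_threshold_sq_of_scaleLoss (C₀ : ℝ) :
    ∃ R₁ : ℝ, 1 ≤ R₁ ∧ ∀ R r : ℝ, R₁ ≤ R → 0 < r → R ≤ C₀ * Real.log R ^ 6 * r → R ≤ r ^ 2 := by
  -- `(log x)^12 = o(x)`: eventually `(C₀² + 1)·(log R)^12 ≤ R`
  have hlo : (fun x : ℝ => Real.log x ^ 12) =o[atTop] id := Real.isLittleO_pow_log_id_atTop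
  have hc : 0 < (C₀ ^ 2 + 1)⁻¹ := by positivity
  have hev := hlo.def hc
  rw [Filter.eventually_atTop] at hev
  obtain ⟨R₀, hR₀⟩ := hev
  refine ⟨max R₀ 1, le_max_right _ _, fun R r hR hr hloss => ?_⟩
  have hR0 : R₀ ≤ R := le_trans (le_max_left _ _) hR
  have hR1 : 1 ≤ R := le_trans (le_max_right _ _) hR
  have hRpos : 0 < R := by linarith
  have hlogR : 0 ≤ Real.log R := Real.log_nonneg hR1
  have h1 := hR₀ R hR0
  rw [Real.norm_of_nonneg (pow_nonneg hlogR 12), id, Real.norm_of_nonneg hRpos.le] at h1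
  -- `(C₀²+1)(log R)^12 ≤ R`
  have h2 : (C₀ ^ 2 + 1) * Real.log R ^ 12 ≤ R := by
    have := mul_le_mul_of_nonneg_left h1 (le_of_lt (by positivity : (0 : ℝ) < C₀ ^ 2 + 1))
    rwa [← mul_assoc, mul_inv_cancel₀ (by positivity : (C₀ ^ 2 + 1 : ℝ) ≠ 0), one_mul] at this
  -- square the scale loss: `R² ≤ C₀²(log R)¹² r² ≤ R·r²`
  have h3 : R ^ 2 ≤ (C₀ * Real.log R ^ 6 * r) ^ 2 := pow_le_pow_left₀ hRpos.le hloss 2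
  have h4 : (C₀ * Real.log R ^ 6 * r) ^ 2 = C₀ ^ 2 * Real.log R ^ 12 * r ^ 2 := by ring
  have h5 : C₀ ^ 2 * Real.log R ^ 12 ≤ R := by nlinarith [pow_nonneg hlogR 12]
  have h6 : R ^ 2 ≤ R * r ^ 2 := by
    calc R ^ 2 ≤ C₀ ^ 2 * Real.log R ^ 12 * r ^ 2 := by rw [← h4]; exact h3
      _ ≤ R * r ^ 2 := mul_le_mul_of_nonneg_right h5 (sq_nonneg r)
  nlinarith [sq_nonneg r]

/-- ★ Past the threshold of ✓`exists_threshold_sq_of_scaleLoss`: `log R ≤ 2·log r` (from `R ≤ r²`, `0 < R`). [folklore] -/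
theorem log_le_two_mul_log_of_le_sq {R r : ℝ} (hR : 0 < R) (h : R ≤ r ^ 2) : Real.log R ≤ 2 * Real.log r := by
  have h1 : Real.log R ≤ Real.log (r ^ 2) := Real.log_le_log hR h
  rwa [Real.log_pow, Nat.cast_ofNat] at h1

/-- ★ **THE SQUARE-ROOT READING OF A LINEAR SCALE LOSS**: `0 < r`, `0 < R`, `0 ≤ C`, `R ≤ C·r` ⟹ `(√r)⁻¹ ≤ √C·(√R)⁻¹`. [folklore] -/
theorem inv_sqrt_le_of_le_mul {R r C : ℝ} (hR : 0 < R) (hr : 0 < r) (hC : 0 ≤ C) (h : R ≤ C * r) :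
    (Real.sqrt r)⁻¹ ≤ Real.sqrt C * (Real.sqrt R)⁻¹ := by
  have hsr : 0 < Real.sqrt r := Real.sqrt_pos.mpr hr
  have hsR : 0 < Real.sqrt R := Real.sqrt_pos.mpr hR
  have h1 : Real.sqrt R ≤ Real.sqrt C * Real.sqrt r := by
    rw [← Real.sqrt_mul hC]
    exact Real.sqrt_le_sqrt h
  rw [← one_div, ← div_eq_mul_inv, div_le_div_iff₀ hsr hsR, one_mul]
  exact h1

/-- ★ The same for the scale loss of `hImprove` v1: `1 ≤ R`, `0 < r`, `0 ≤ C₀`, `R ≤ C₀·(log R)⁶·r` ⟹ `(√r)⁻¹ ≤ √C₀·(log R)³·(√R)⁻¹`. [folklore] -/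
theorem inv_sqrt_le_of_scaleLoss {R r C₀ : ℝ} (hR : 1 ≤ R) (hr : 0 < r) (hC : 0 ≤ C₀) (hloss : R ≤ C₀ * Real.log R ^ 6 * r) :
    (Real.sqrt r)⁻¹ ≤ Real.sqrt C₀ * Real.log R ^ 3 * (Real.sqrt R)⁻¹ := by
  have hRpos : 0 < R := by linarith
  have hlogR : 0 ≤ Real.log R := Real.log_nonneg hR
  have h1 : (Real.sqrt r)⁻¹ ≤ Real.sqrt (C₀ * Real.log R ^ 6) * (Real.sqrt R)⁻¹ :=
    inv_sqrt_le_of_le_mul hRpos hr (mul_nonneg hC (pow_nonneg hlogR 6)) (by simpa [mul_assoc] using hloss)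
  have h2 : Real.sqrt (C₀ * Real.log R ^ 6) = Real.sqrt C₀ * Real.log R ^ 3 := by
    rw [Real.sqrt_mul hC, show Real.log R ^ 6 = (Real.log R ^ 3) ^ 2 by ring, Real.sqrt_sq (pow_nonneg hlogR 3)]
  rwa [h2] at h1

/-- ★★ **READ-BACK WITHOUT LOG LOSS** (recipe step 8 at exponent 6; ★w2 g11's 06:05:39Z erratum ∕ LEAD g9 06:26:40Z word): if `1 < R`, `0 < r`, `0 ≤ C₀`,
`R ≤ C₀·(log R)⁶·r` and `R ≤ r²` (past the threshold), then for every `a ≥ 0`, `a / (√r · (log r)³) ≤ 8·√C₀ · a / √R` — the `(log r)⁻³` gain of the organ's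
`ε₀∕log⁶` smallness exactly pays the `(log R)³` of the scale loss. [folklore] -/
theorem readBack_le_of_scaleLoss {R r C₀ a : ℝ} (hR : 1 < R) (hr : 0 < r) (hC : 0 ≤ C₀) (hloss : R ≤ C₀ * Real.log R ^ 6 * r) (hsq : R ≤ r ^ 2)
    (ha : 0 ≤ a) :
    a / (Real.sqrt r * Real.log r ^ 3) ≤ 8 * Real.sqrt C₀ * a / Real.sqrt R := by
  have hRpos : 0 < R := by linarith
  have hlogR : 0 < Real.log R := Real.log_pos hR
  have hlog2 : Real.log R ≤ 2 * Real.log r := log_le_two_mul_log_of_le_sq hRpos hsq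
  have hlogr : 0 < Real.log r := by linarith
  -- `(√r)⁻¹ ≤ √C₀ (log R)³ (√R)⁻¹`
  have h1 : (Real.sqrt r)⁻¹ ≤ Real.sqrt C₀ * Real.log R ^ 3 * (Real.sqrt R)⁻¹ := inv_sqrt_le_of_scaleLoss hR.le hr hC hloss
  -- `(log r)⁻³ ≤ 8·(log R)⁻³`
  have h2 : (Real.log r ^ 3)⁻¹ ≤ 8 * (Real.log R ^ 3)⁻¹ := by
    have hlr3 : 0 < Real.log r ^ 3 := pow_pos hlogr 3
    have hlR3 : 0 < Real.log R ^ 3 := pow_pos hlogR 3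
    rw [inv_le_comm₀ hlr3 (by positivity), mul_inv, inv_inv]
    have : Real.log R ^ 3 ≤ (2 * Real.log r) ^ 3 := pow_le_pow_left₀ hlogR.le hlog2 3
    have h8 : (8 : ℝ)⁻¹ * Real.log R ^ 3 ≤ Real.log r ^ 3 := by nlinarith
    simpa [mul_comm] using h8
  have hsr : 0 < Real.sqrt r := Real.sqrt_pos.mpr hr
  have hsR : 0 < Real.sqrt R := Real.sqrt_pos.mpr hRpos
  have hlR3 : 0 < Real.log R ^ 3 := pow_pos hlogR 3
  calc a / (Real.sqrt r * Real.log r ^ 3) = a * ((Real.sqrt r)⁻¹ * (Real.log r ^ 3)⁻¹) := by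
        rw [div_eq_mul_inv, mul_inv]
    _ ≤ a * ((Real.sqrt C₀ * Real.log R ^ 3 * (Real.sqrt R)⁻¹) * (8 * (Real.log R ^ 3)⁻¹)) := by
        refine mul_le_mul_of_nonneg_left ?_ ha
        exact mul_le_mul h1 h2 (inv_nonneg.mpr (pow_nonneg hlogr.le 3)) (by positivity)
    _ = 8 * Real.sqrt C₀ * a / Real.sqrt R := by
        field_simp

/-! ## §3 The face algebra at the [T2] box radius `R′ = min R (c·θ^{−1/2})` (RULING g9-2) -/

/-- ★ **AM–GM FOR THE HÖLDER FACE**: `0 < R` ⟹ `2·√(√θ) ≤ (√R)⁻¹ + √θ·√R` (the face `(√R)⁻¹ + √θ√R` of `hRegH` is never below `2θ^{1/4}`; `Real.sqrt` conventions make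
the sign of `θ` irrelevant). [folklore] -/
theorem two_mul_sqrt_sqrt_le {R : ℝ} (θ : ℝ) (hR : 0 < R) :
    2 * Real.sqrt (Real.sqrt θ) ≤ (Real.sqrt R)⁻¹ + Real.sqrt θ * Real.sqrt R := by
  set p := Real.sqrt (Real.sqrt R) with hp_def
  set t := Real.sqrt (Real.sqrt θ) with ht_def
  have hsR : 0 < Real.sqrt R := Real.sqrt_pos.mpr hR
  have hp : 0 < p := Real.sqrt_pos.mpr hsR
  have ht : 0 ≤ t := Real.sqrt_nonneg _
  have hpp : p * p = Real.sqrt R := Real.mul_self_sqrt hsR.le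
  have htt : t * t = Real.sqrt θ := Real.mul_self_sqrt (Real.sqrt_nonneg θ)
  rw [← hpp, ← htt]
  have hpp0 : 0 < p * p := by positivity
  have key : 2 * t * (p * p) ≤ 1 + t * t * (p * p) * (p * p) := by nlinarith [sq_nonneg (t * (p * p) - 1)]
  calc 2 * t = 2 * t * (p * p) / (p * p) := by field_simp
    _ ≤ (1 + t * t * (p * p) * (p * p)) / (p * p) := div_le_div_of_nonneg_right key hpp0.le
    _ = (p * p)⁻¹ + t * t * (p * p) := by field_simp

/-- ★ `rpow` twin of ✓`two_mul_sqrt_sqrt_le`: `2·θ^{1/4} ≤ (√R)⁻¹ + √θ·√R`. [folklore] -/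
theorem two_mul_rpow_quarter_le {R θ : ℝ} (hR : 0 < R) (hθ : 0 ≤ θ) :
    2 * θ ^ ((1 : ℝ) / 4) ≤ (Real.sqrt R)⁻¹ + Real.sqrt θ * Real.sqrt R := by
  have h : θ ^ ((1 : ℝ) / 4) = Real.sqrt (Real.sqrt θ) := by
    rw [Real.sqrt_eq_rpow, Real.sqrt_eq_rpow, ← Real.rpow_mul hθ]
    norm_num
  rw [h]
  exact two_mul_sqrt_sqrt_le θ hR

/-- ★ The regime inequality at the [T2] radius: `0 < θ`, `0 ≤ c`, `0 ≤ R` ⟹ `θ·(min R (c/√θ))² ≤ c²` (so the twist row `τ₀·R′ ≤ C₀⁻¹` of `hImprove` is met by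
`R′ := min R (c₀/√θ)` once `τ₀ ≤ 8R′θ`-type and `8c₀² ≤ C₀⁻¹`). [folklore] -/
theorem theta_mul_sq_min_le {R θ c : ℝ} (hθ : 0 < θ) (hc : 0 ≤ c) (hR : 0 ≤ R) :
    θ * (min R (c / Real.sqrt θ)) ^ 2 ≤ c ^ 2 := by
  have hsθ : 0 < Real.sqrt θ := Real.sqrt_pos.mpr hθ
  have hm0 : 0 ≤ min R (c / Real.sqrt θ) := le_min hR (div_nonneg hc hsθ.le)
  have hm1 : min R (c / Real.sqrt θ) ≤ c / Real.sqrt θ := min_le_right _ _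
  have h2 : Real.sqrt θ * min R (c / Real.sqrt θ) ≤ c := by
    have := mul_le_mul_of_nonneg_left hm1 hsθ.le
    rwa [mul_div_cancel₀ _ hsθ.ne'] at this
  have h3 : (Real.sqrt θ * min R (c / Real.sqrt θ)) ^ 2 ≤ c ^ 2 := pow_le_pow_left₀ (mul_nonneg hsθ.le hm0) h2 2
  calc θ * (min R (c / Real.sqrt θ)) ^ 2 = (Real.sqrt θ * min R (c / Real.sqrt θ)) ^ 2 := by
        rw [mul_pow, Real.sq_sqrt hθ.le]
    _ ≤ c ^ 2 := h3

/-- ★★ **THE FACE AT THE MINIMUM RADIUS** (RULING g9-2's read-back): for `0 < θ`, `0 < R`, `0 < c ≤ 1` and `R′ := min R (c/√θ)`,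
`(√R′)⁻¹ + √θ·√R′ ≤ ((√c)⁻¹ + 1)·((√R)⁻¹ + √θ·√R)` — on the branch `R′ = R` trivially, on the branch `R′ = c/√θ` because the left side is `(c^{−1/2} + c^{1/2})·θ^{1/4}`
and the right side is at least `(c^{−1/2} + 1)·2θ^{1/4}` (✓`two_mul_sqrt_sqrt_le`).  One `Λ` therefore serves every `R`. [folklore] -/
theorem face_min_radius_le {R θ c : ℝ} (hθ : 0 < θ) (hR : 0 < R) (hc : 0 < c) (hc1 : c ≤ 1) :
    (Real.sqrt (min R (c / Real.sqrt θ)))⁻¹ + Real.sqrt θ * Real.sqrt (min R (c / Real.sqrt θ)) ≤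
      ((Real.sqrt c)⁻¹ + 1) * ((Real.sqrt R)⁻¹ + Real.sqrt θ * Real.sqrt R) := by
  have hsθ : 0 < Real.sqrt θ := Real.sqrt_pos.mpr hθ
  have hsc : 0 < Real.sqrt c := Real.sqrt_pos.mpr hc
  have hsc1 : Real.sqrt c ≤ 1 := by rw [← Real.sqrt_one]; exact Real.sqrt_le_sqrt hc1
  have hX : 0 ≤ (Real.sqrt R)⁻¹ + Real.sqrt θ * Real.sqrt R := by positivity
  have hfac : 1 ≤ (Real.sqrt c)⁻¹ + 1 := by
    have : 0 ≤ (Real.sqrt c)⁻¹ := inv_nonneg.mpr hsc.le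
    linarith
  rcases le_total R (c / Real.sqrt θ) with hle | hle
  · -- branch `R′ = R`
    rw [min_eq_left hle]
    calc (Real.sqrt R)⁻¹ + Real.sqrt θ * Real.sqrt R = 1 * ((Real.sqrt R)⁻¹ + Real.sqrt θ * Real.sqrt R) := (one_mul _).symm
      _ ≤ ((Real.sqrt c)⁻¹ + 1) * ((Real.sqrt R)⁻¹ + Real.sqrt θ * Real.sqrt R) := mul_le_mul_of_nonneg_right hfac hX
  · -- branch `R′ = c/√θ`
    rw [min_eq_right hle]
    set t := Real.sqrt (Real.sqrt θ) with ht_def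
    have ht : 0 < t := Real.sqrt_pos.mpr hsθ
    have htt : t * t = Real.sqrt θ := Real.mul_self_sqrt hsθ.le
    -- `√(c/√θ) = √c / t`
    have hroot : Real.sqrt (c / Real.sqrt θ) = Real.sqrt c / t := by
      rw [Real.sqrt_div hc.le, ht_def]
    have hL : (Real.sqrt (c / Real.sqrt θ))⁻¹ + Real.sqrt θ * Real.sqrt (c / Real.sqrt θ) = t * ((Real.sqrt c)⁻¹ + Real.sqrt c) := by
      rw [hroot, ← htt]
      field_simp
    have hAMGM : 2 * t ≤ (Real.sqrt R)⁻¹ + Real.sqrt θ * Real.sqrt R := two_mul_sqrt_sqrt_le θ hR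
    rw [hL]
    have h1 : t * ((Real.sqrt c)⁻¹ + Real.sqrt c) ≤ t * ((Real.sqrt c)⁻¹ + 1) := by
      refine mul_le_mul_of_nonneg_left ?_ ht.le
      linarith
    have h2 : t * ((Real.sqrt c)⁻¹ + 1) ≤ ((Real.sqrt c)⁻¹ + 1) * ((Real.sqrt R)⁻¹ + Real.sqrt θ * Real.sqrt R) := by
      rw [mul_comm]
      refine mul_le_mul_of_nonneg_left ?_ (le_trans zero_le_one hfac)
      linarith
    exact le_trans h1 h2

/-- ★★ ✓`face_min_radius_le` with the radius named: `R′ = min R (c/√θ)` ⟹ `(√R′)⁻¹ + √θ·√R′ ≤ ((√c)⁻¹ + 1)·((√R)⁻¹ + √θ·√R)`. [folklore] -/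
theorem face_of_min_radius {R R' θ c : ℝ} (hθ : 0 < θ) (hR : 0 < R) (hc : 0 < c) (hc1 : c ≤ 1) (hR' : R' = min R (c / Real.sqrt θ)) :
    (Real.sqrt R')⁻¹ + Real.sqrt θ * Real.sqrt R' ≤ ((Real.sqrt c)⁻¹ + 1) * ((Real.sqrt R)⁻¹ + Real.sqrt θ * Real.sqrt R) := by
  subst hR'
  exact face_min_radius_le hθ hR hc hc1

end Summit.QuantumFields.YangMills.Theorems.PoincareLipschitzKnitScaleLetters

end
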